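import Literature.Analysis.FluidPDE.ElgindiHkClosure
import Literature.Analysis.FluidPDE.ElgindiAprioriCutoff
import Literature.Analysis.FluidPDE.ElgindiCommutatorCalculus
import Mathlib.Analysis.SpecialFunctions.Trigonometric.ArctanDeriv
import Literature.Analysis.Distribution.DivFormRegularity
import Mathlib.MeasureTheory.Integral.Lebesgue.DominatedConvergence
import HarnessLib

/-!
# Density of the test functions: cut-offs in `log R` and `log tan θ`
([Elgindi2021] Remark 8.3; [ElgindiGhoulMasmoudi2021] Remark 9.8 "cut-off procedure")

Topic `Literature/Analysis/FluidPDE`. Support file (definitions with bodies and proved theorems, no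
named facts) on the proof path of the named fact
`Literature.Analysis.FluidPDE.Elgindi.ElgindiGhoulMasmoudi2021_stabilityCore`
(`ElgindiStabilityDecomposition.lean`). T. M. Elgindi, Ann. of Math. 194 (2021) =
arXiv:1904.04795, §8.1 Remark 8.3 (p. 25); Elgindi–Ghoul–Masmoudi, arXiv:1910.14071, §9 Remark 9.8
(p. 22).

In the variable `t = log tan θ` the operator `D_θ = sin(2θ)∂_θ` is `2∂_t`, so plateau cut-offs in
`t/ν` have all `D_θ`-iterates `O(1/ν)` (exactly as the radial cut-offs `η_ν(R)` of
`ElgindiAprioriCutoff.lean` do for `D_R`). For `f ∈ C^∞(strip)` with finite `𝓗⁴` functional and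
finite `γ`-weighted radial words `Σ_{j≤3}∫∫w²(D_z^jf)²sin(2θ)^{−γ}`, the compactly supported
`f_ν = κ_ν(θ)η_ν(R)f` satisfy `|f_ν − f|²_{𝓗⁴} → 0` (`exists_hkApprox`): Remark 8.3 for the
class on which the papers' estimates are used.
-/

noncomputable section

open MeasureTheory Set Function Real Filter Finset
open _root_.Topology
open scoped ENNReal ContDiff

namespace Literature.Analysis.FluidPDE

namespace Elgindi

/-! ### Angular multipliers and their Leibniz formula on the strip -/

/-- The angular product `(κ ⊙ f)(z, θ) = κ(θ) f(z, θ)`. [folklore] -/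
def angMul (κ : ℝ → ℝ) (f : ℝ → ℝ → ℝ) : ℝ → ℝ → ℝ := fun z θ => κ θ * f z θ

/-- Unfolding `angMul`. [folklore] -/
@[simp] theorem angMul_apply (κ : ℝ → ℝ) (f : ℝ → ℝ → ℝ) (z θ : ℝ) : angMul κ f z θ = κ θ * f z θ := rfl

/-- `D_z(κ ⊙ f) = κ ⊙ D_zf`, globally. [folklore] -/
theorem Dz_angMul (κ : ℝ → ℝ) (f : ℝ → ℝ → ℝ) : Dz (angMul κ f) = angMul κ (Dz f) := by
  funext z θ
  simp only [Dz_apply, angMul, deriv_const_mul_field]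
  ring

/-- `D_z^j(κ ⊙ f) = κ ⊙ D_z^jf`, globally. [folklore] -/
theorem iterate_Dz_angMul (κ : ℝ → ℝ) (f : ℝ → ℝ → ℝ) (j : ℕ) : Dz^[j] (angMul κ f) = angMul κ (Dz^[j] f) := by
  induction j generalizing f with
  | zero => rfl
  | succ j ih => rw [Function.iterate_succ_apply, Function.iterate_succ_apply, Dz_angMul, ih]

/-- **The binomial Leibniz formula for `D_θ^i(κ ⊙ g)` on the strip**, `κ ∈ C^N(0,π/2)`,
`g ∈ C^N(strip)`, `i ≤ N`. [folklore] -/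
theorem iterate_Dθ_angMul_strip {κ : ℝ → ℝ} {g : ℝ → ℝ → ℝ} {N : ℕ} (hκ : ContDiffOn ℝ N κ (Ioo 0 (π / 2)))
    (hg : ContDiffOn ℝ N (uncurry g) strip) {i : ℕ} (hi : i ≤ N) :
    ∀ p ∈ strip, (Dθ^[i] (angMul κ g)) p.1 p.2 = ∑ a ∈ range (i + 1), (i.choose a : ℝ) * ((Dθ₁^[a] κ) p.2 * (Dθ^[i - a] g) p.1 p.2) := by
  induction i with
  | zero => intro p _; simp
  | succ i ih =>
    intro p hp
    have ih' := ih (by omega)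
    set G : ℝ → ℝ → ℝ := fun z θ => ∑ a ∈ range (i + 1), (i.choose a : ℝ) * ((Dθ₁^[a] κ) θ * (Dθ^[i - a] g) z θ) with hG
    have eG : ∀ q ∈ strip, (Dθ^[i] (angMul κ g)) q.1 q.2 = G q.1 q.2 := fun q hq => ih' q hq
    rw [Function.iterate_succ_apply', Dθ_congr eG hp]
    -- `Dθ₁^a κ` is `C^{N-a}` on `(0, π/2)`
    have hκa : ∀ a, a ≤ i → ContDiffOn ℝ 1 (Dθ₁^[a] κ) (Ioo 0 (π / 2)) := by
      intro a ha
      have key : ∀ a m, a + m ≤ N → ContDiffOn ℝ m (Dθ₁^[a] κ) (Ioo 0 (π / 2)) := by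
        intro a
        induction a with
        | zero => intro m hm; exact hκ.of_le (by exact_mod_cast (by omega : m ≤ N))
        | succ a iha =>
          intro m hm
          have h1 := iha (m + 1) (by omega)
          rw [Function.iterate_succ']
          have hd : ContDiffOn ℝ m (deriv (Dθ₁^[a] κ)) (Ioo 0 (π / 2)) := h1.deriv_of_isOpen isOpen_Ioo (by simp)
          exact ((Real.contDiff_sin.comp (contDiff_const.mul contDiff_id)).contDiffOn.of_le le_top).mul hd
      exact key a 1 (by omega)
    have hterm : ∀ a ∈ range (i + 1),
        HasDerivAt (fun θ' => (i.choose a : ℝ) * ((Dθ₁^[a] κ) θ' * (Dθ^[i - a] g) p.1 θ'))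
          ((i.choose a : ℝ) * (deriv (Dθ₁^[a] κ) p.2 * (Dθ^[i - a] g) p.1 p.2 + (Dθ₁^[a] κ) p.2 * dθ (Dθ^[i - a] g) p.1 p.2)) p.2 := by
      intro a ha
      have ha' : a ≤ i := Nat.lt_succ_iff.mp (mem_range.mp ha)
      have hκd : HasDerivAt (Dθ₁^[a] κ) (deriv (Dθ₁^[a] κ) p.2) p.2 :=
        (((hκa a ha').differentiableOn (by simp)).differentiableAt (isOpen_Ioo.mem_nhds hp.2)).hasDerivAt
      have hgl : ContDiffOn ℝ 1 (uncurry (Dθ^[i - a] g)) strip := contDiffOn_iterate_Dθ hg (by omega)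
      have hgd : HasDerivAt (fun θ' => (Dθ^[i - a] g) p.1 θ') (dθ (Dθ^[i - a] g) p.1 p.2) p.2 := by
        have := hasDerivAt_slice_snd (differentiableAt_of_contDiffOn_strip hgl one_ne_zero hp)
        rwa [← dθ_eq_fderiv (differentiableAt_of_contDiffOn_strip hgl one_ne_zero hp)] at this
      exact (hκd.mul hgd).const_mul _
    have hsum : HasDerivAt (fun θ' => G p.1 θ')
        (∑ a ∈ range (i + 1), (i.choose a : ℝ) * (deriv (Dθ₁^[a] κ) p.2 * (Dθ^[i - a] g) p.1 p.2 + (Dθ₁^[a] κ) p.2 * dθ (Dθ^[i - a] g) p.1 p.2)) p.2 := by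
      have := HasDerivAt.sum hterm
      refine this.congr_of_eventuallyEq (Eventually.of_forall fun θ' => ?_)
      simp [hG, Finset.sum_apply]
    rw [Dθ_eq_mul_dθ, dθ, hsum.deriv]
    simp only [Finset.mul_sum]
    have key : ∀ a ∈ range (i + 1),
        Real.sin (2 * p.2) * ((i.choose a : ℝ) * (deriv (Dθ₁^[a] κ) p.2 * (Dθ^[i - a] g) p.1 p.2 + (Dθ₁^[a] κ) p.2 * dθ (Dθ^[i - a] g) p.1 p.2)) =
        (i.choose a : ℝ) * ((Dθ₁^[a + 1] κ) p.2 * (Dθ^[i - a] g) p.1 p.2) +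
          (i.choose a : ℝ) * ((Dθ₁^[a] κ) p.2 * (Dθ^[i + 1 - a] g) p.1 p.2) := by
      intro a ha
      have ha' : a ≤ i := Nat.lt_succ_iff.mp (mem_range.mp ha)
      have e : i + 1 - a = (i - a) + 1 := by omega
      rw [e, Function.iterate_succ_apply', Function.iterate_succ_apply', Dθ₁_apply, Dθ_eq_mul_dθ]
      ring
    rw [Finset.sum_congr rfl key, Finset.sum_add_distrib]
    rw [Finset.sum_choose_succ_mul (fun a m => (Dθ₁^[a] κ) p.2 * (Dθ^[m] g) p.1 p.2) i, add_comm]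

/-- **Mixed words of `κ ⊙ g` on the strip**: `D_θ^iD_z^j(κ ⊙ g) = Σ_a C(i,a)(Dθ₁^aκ)·D_θ^{i−a}D_z^jg`. [folklore] -/
theorem iterate_Dθ_Dz_angMul_strip {κ : ℝ → ℝ} {g : ℝ → ℝ → ℝ} {N : ℕ} (hκ : ContDiffOn ℝ N κ (Ioo 0 (π / 2)))
    (hg : ContDiffOn ℝ N (uncurry g) strip) {i j : ℕ} (h : i + j ≤ N) :
    ∀ p ∈ strip, (Dθ^[i] (Dz^[j] (angMul κ g))) p.1 p.2 = ∑ a ∈ range (i + 1), (i.choose a : ℝ) * ((Dθ₁^[a] κ) p.2 * (Dθ^[i - a] (Dz^[j] g)) p.1 p.2) := by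
  intro p hp
  rw [iterate_Dz_angMul]
  exact iterate_Dθ_angMul_strip (N := N - j) (hκ.of_le (by exact_mod_cast Nat.sub_le N j)) (contDiffOn_iterate_Dz hg (by omega)) (by omega) p hp

/-! ### The angular cut-off in the variable `log tan θ` -/

/-- Locality of `Dθ₁`-iterates on open sets. [folklore] -/
theorem iterate_Dθ₁_congr_open {g h : ℝ → ℝ} {U : Set ℝ} (hU : IsOpen U) (hgh : EqOn g h U) (a : ℕ) : EqOn (Dθ₁^[a] g) (Dθ₁^[a] h) U := by
  induction a generalizing g h with
  | zero => exact hgh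
  | succ a ih =>
    intro θ hθ
    rw [Function.iterate_succ_apply, Function.iterate_succ_apply]
    refine ih (fun t ht => ?_) hθ
    rw [Dθ₁_apply, Dθ₁_apply, (hgh.eventuallyEq_of_mem (hU.mem_nhds ht)).deriv_eq]

/-- **`Dθ₁(G ∘ tan) = 2(Dz₁G) ∘ tan` on `(0, π/2)`**: in `t = log tan θ`, `D_θ = 2∂_t`. [folklore] -/
theorem Dθ₁_comp_tan {G : ℝ → ℝ} {θ : ℝ} (hθ : θ ∈ Ioo 0 (π / 2)) (hG : DifferentiableAt ℝ G (Real.tan θ)) :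
    Dθ₁ (fun t => G (Real.tan t)) θ = 2 * Dz₁ G (Real.tan θ) := by
  have hc : Real.cos θ ≠ 0 := (Real.cos_pos_of_mem_Ioo ⟨by linarith [hθ.1, Real.pi_pos], hθ.2⟩).ne'
  have hd : HasDerivAt (fun t => G (Real.tan t)) (deriv G (Real.tan θ) * (1 / Real.cos θ ^ 2)) θ :=
    hG.hasDerivAt.comp θ (Real.hasDerivAt_tan hc)
  rw [Dθ₁_apply, hd.deriv, Dz₁_apply, Real.sin_two_mul, Real.tan_eq_sin_div_cos]
  field_simp

/-- Iterating: `Dθ₁^a(G ∘ tan) = 2^a(Dz₁^aG) ∘ tan` on `(0, π/2)` for `G ∈ C^∞`. [folklore] -/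
theorem iterate_Dθ₁_comp_tan {G : ℝ → ℝ} (hG : ∀ a, DifferentiableOn ℝ (Dz₁^[a] G) (Ioi 0)) (a : ℕ) :
    EqOn (Dθ₁^[a] fun t => G (Real.tan t)) (fun θ => 2 ^ a * (Dz₁^[a] G) (Real.tan θ)) (Ioo 0 (π / 2)) := by
  induction a with
  | zero => intro θ _; simp
  | succ a ih =>
    intro θ hθ
    rw [Function.iterate_succ_apply']
    have e1 := iterate_Dθ₁_congr_open isOpen_Ioo ih 1 hθ
    simp only [Function.iterate_one] at e1
    rw [e1]
    show Dθ₁ (fun θ => 2 ^ a * (Dz₁^[a] G) (Real.tan θ)) θ = 2 ^ (a + 1) * (Dz₁^[a + 1] G) (Real.tan θ)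
    have hd : DifferentiableAt ℝ (Dz₁^[a] G) (Real.tan θ) :=
      (hG a).differentiableAt (isOpen_Ioi.mem_nhds (Real.tan_pos_of_pos_of_lt_pi_div_two hθ.1 hθ.2))
    rw [Dθ₁_const_mul]
    show 2 ^ a * Dθ₁ (fun θ => (Dz₁^[a] G) (Real.tan θ)) θ = 2 ^ (a + 1) * (Dz₁^[a + 1] G) (Real.tan θ)
    rw [Dθ₁_comp_tan hθ hd, Function.iterate_succ_apply']
    ring

/-- The angular cut-off `κ_ν(θ) = η_ν(tan θ)` on `(0, π/2)`, `0` elsewhere. [folklore] -/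
def angCut (n : ℝ) (θ : ℝ) : ℝ := if θ ∈ Ioo 0 (π / 2) then etaCut n (Real.tan θ) else 0

/-- On the open interval `κ_ν = η_ν ∘ tan`. [folklore] -/
theorem angCut_of_mem {n θ : ℝ} (hθ : θ ∈ Ioo 0 (π / 2)) : angCut n θ = etaCut n (Real.tan θ) := if_pos hθ

/-- `|κ_ν| ≤ 1`. [folklore] -/
theorem abs_angCut_le (n θ : ℝ) : |angCut n θ| ≤ 1 := by
  unfold angCut; split_ifs
  · exact abs_etaCut_le _ _
  · simp

/-- `0 ≤ η_ν ≤ 1`. [folklore] -/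
theorem etaCut_mem_Icc (n z : ℝ) : etaCut n z ∈ Icc (0:ℝ) 1 :=
  ⟨logPlateauBump.nonneg' _, logPlateauBump.le_one⟩

/-- `0 ≤ κ_ν ≤ 1`. [folklore] -/
theorem angCut_mem_Icc (n θ : ℝ) : angCut n θ ∈ Icc (0:ℝ) 1 := by
  unfold angCut; split_ifs
  · exact etaCut_mem_Icc _ _
  · exact ⟨le_rfl, zero_le_one⟩

/-- `κ_ν` vanishes below `arctan(e^{−2ν})`. [folklore] -/
theorem angCut_eq_zero_of_lt {n : ℝ} (hn : 0 < n) {θ : ℝ} (hθ : θ < Real.arctan (Real.exp (-(2 * n)))) : angCut n θ = 0 := by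
  unfold angCut
  split_ifs with h
  · apply etaCut_eq_zero hn
    have ht0 : 0 < Real.tan θ := Real.tan_pos_of_pos_of_lt_pi_div_two h.1 h.2
    have hlt : Real.tan θ < Real.exp (-(2 * n)) := by
      have := Real.tan_lt_tan_of_lt_of_lt_pi_div_two (by linarith [h.1, Real.pi_pos]) (Real.arctan_lt_pi_div_two _) hθ
      rwa [Real.tan_arctan] at this
    have hlog : Real.log (Real.tan θ) < -(2 * n) := by
      have := Real.log_lt_log ht0 hlt; rwa [Real.log_exp] at this
    rw [abs_of_neg (by linarith)]; linarith
  · rfl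

/-- `κ_ν` vanishes above `arctan(e^{2ν})`. [folklore] -/
theorem angCut_eq_zero_of_gt {n : ℝ} (hn : 0 < n) {θ : ℝ} (hθ : Real.arctan (Real.exp (2 * n)) < θ) : angCut n θ = 0 := by
  unfold angCut
  split_ifs with h
  · apply etaCut_eq_zero hn
    have hlt : Real.exp (2 * n) < Real.tan θ := by
      have := Real.tan_lt_tan_of_lt_of_lt_pi_div_two (by linarith [Real.arctan_pos.2 (Real.exp_pos (2 * n)), Real.pi_pos]) h.2 hθ
      rwa [Real.tan_arctan] at this
    have hlog : 2 * n < Real.log (Real.tan θ) := by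
      have := Real.log_lt_log (Real.exp_pos _) hlt; rwa [Real.log_exp] at this
    rw [abs_of_pos (by linarith)]; linarith
  · rfl

/-- The two thresholds lie inside `(0, π/2)`. [folklore] -/
theorem arctan_exp_mem (x : ℝ) : Real.arctan (Real.exp x) ∈ Ioo 0 (π / 2) :=
  ⟨Real.arctan_pos.2 (Real.exp_pos x), Real.arctan_lt_pi_div_two _⟩

/-- `κ_ν` is smooth on `ℝ`. [folklore] -/
theorem contDiff_angCut {n : ℝ} (hn : 0 < n) : ContDiff ℝ ∞ (angCut n) := by
  refine contDiff_iff_contDiffAt.2 fun θ => ?_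
  by_cases h1 : θ < Real.arctan (Real.exp (-(2 * n)))
  · have : angCut n =ᶠ[𝓝 θ] fun _ => 0 := by
      filter_upwards [Iio_mem_nhds h1] with t ht using angCut_eq_zero_of_lt hn ht
    exact contDiffAt_const.congr_of_eventuallyEq this
  by_cases h2 : Real.arctan (Real.exp (2 * n)) < θ
  · have : angCut n =ᶠ[𝓝 θ] fun _ => 0 := by
      filter_upwards [Ioi_mem_nhds h2] with t ht using angCut_eq_zero_of_gt hn ht
    exact contDiffAt_const.congr_of_eventuallyEq this
  · rw [not_lt] at h1 h2
    have hθ : θ ∈ Ioo 0 (π / 2) := ⟨(arctan_exp_mem _).1.trans_le h1, h2.trans_lt (arctan_exp_mem _).2⟩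
    have heq : angCut n =ᶠ[𝓝 θ] fun t => etaCut n (Real.tan t) := by
      filter_upwards [isOpen_Ioo.mem_nhds hθ] with t ht using angCut_of_mem ht
    refine ContDiffAt.congr_of_eventuallyEq ?_ heq
    have htan : ContDiffAt ℝ ∞ Real.tan θ := Real.contDiffAt_tan.2 (Real.cos_pos_of_mem_Ioo ⟨by linarith [hθ.1, Real.pi_pos], hθ.2⟩).ne'
    have hpos : 0 < Real.tan θ := Real.tan_pos_of_pos_of_lt_pi_div_two hθ.1 hθ.2
    exact ((contDiffOn_etaCut n).contDiffAt (isOpen_Ioi.mem_nhds hpos)).comp θ htan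

/-- `κ_ν` has compact support. [folklore] -/
theorem hasCompactSupport_angCut {n : ℝ} (hn : 0 < n) : HasCompactSupport (angCut n) := by
  refine HasCompactSupport.of_support_subset_isCompact (isCompact_Icc (a := Real.arctan (Real.exp (-(2 * n)))) (b := Real.arctan (Real.exp (2 * n)))) fun θ hθ => ?_
  rw [mem_support] at hθ
  by_contra h
  rw [Set.mem_Icc, not_and_or, not_le, not_le] at h
  rcases h with h | h
  · exact hθ (angCut_eq_zero_of_lt hn h)
  · exact hθ (angCut_eq_zero_of_gt hn h)

/-- `tsupport κ_ν ⊆ (0, π/2)`. [folklore] -/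
theorem tsupport_angCut {n : ℝ} (hn : 0 < n) : tsupport (angCut n) ⊆ Ioo 0 (π / 2) := by
  have hcl : tsupport (angCut n) ⊆ Icc (Real.arctan (Real.exp (-(2 * n)))) (Real.arctan (Real.exp (2 * n))) := by
    refine closure_minimal (fun θ hθ => ?_) isClosed_Icc
    rw [mem_support] at hθ
    by_contra h
    rw [Set.mem_Icc, not_and_or, not_le, not_le] at h
    rcases h with h | h
    · exact hθ (angCut_eq_zero_of_lt hn h)
    · exact hθ (angCut_eq_zero_of_gt hn h)
  exact hcl.trans fun θ hθ => ⟨(arctan_exp_mem _).1.trans_le hθ.1, hθ.2.trans_lt (arctan_exp_mem _).2⟩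

/-- `κ_ν` is smooth on `(0, π/2)` (finite order, for the Leibniz formulas). [folklore] -/
theorem contDiffOn_angCut {n : ℝ} (hn : 0 < n) (N : ℕ) : ContDiffOn ℝ N (angCut n) (Ioo 0 (π / 2)) := by
  have h := contDiff_angCut hn
  exact (h.of_le (by exact_mod_cast le_top)).contDiffOn

/-- **The `Dθ₁`-iterates of `κ_ν` on `(0, π/2)`**: `Dθ₁^aκ_ν = 2^a(Dz₁^aη_ν) ∘ tan`. [folklore] -/
theorem iterate_Dθ₁_angCut (n : ℝ) (a : ℕ) :
    EqOn (Dθ₁^[a] (angCut n)) (fun θ => 2 ^ a * (Dz₁^[a] (etaCut n)) (Real.tan θ)) (Ioo 0 (π / 2)) := by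
  have hG : ∀ a, DifferentiableOn ℝ (Dz₁^[a] (etaCut n)) (Ioi 0) := fun a =>
    (contDiffOn_iterate_Dz₁_Ioi (N := a + 1) ((contDiffOn_etaCut n).of_le (by exact_mod_cast le_top)) le_rfl).differentiableOn (by simp)
  intro θ hθ
  rw [iterate_Dθ₁_congr_open isOpen_Ioo (fun t ht => angCut_of_mem ht) a hθ]
  exact iterate_Dθ₁_comp_tan hG a hθ

/-- **Bounds**: `|Dθ₁^{a+1}κ_ν| ≤ 2^{a+1}B_a/ν` on `(0, π/2)` for `ν ≥ 1`. [folklore] -/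
theorem abs_iterate_Dθ₁_angCut_le (a : ℕ) : ∃ B, 0 ≤ B ∧ ∀ n : ℝ, 1 ≤ n → ∀ θ ∈ Ioo (0:ℝ) (π / 2), |(Dθ₁^[a + 1] (angCut n)) θ| ≤ B / n := by
  obtain ⟨B, hB0, hB⟩ := abs_iterate_Dz₁_logCut_le contDiff_logPlateau hasCompactSupport_logPlateau a
  refine ⟨2 ^ (a + 1) * B, by positivity, fun n hn θ hθ => ?_⟩
  rw [iterate_Dθ₁_angCut n (a + 1) hθ, abs_mul, abs_of_pos (by positivity : (0:ℝ) < 2 ^ (a + 1)), mul_div_assoc]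
  exact mul_le_mul_of_nonneg_left (hB n hn _ (Real.tan_pos_of_pos_of_lt_pi_div_two hθ.1 hθ.2)) (by positivity)

/-- `κ_{n+1}(θ) → 1` on `(0, π/2)`. [folklore] -/
theorem tendsto_angCut {θ : ℝ} (hθ : θ ∈ Ioo 0 (π / 2)) : Tendsto (fun n : ℕ => angCut (n + 1 : ℝ) θ) atTop (𝓝 1) := by
  simp only [angCut_of_mem hθ]; exact tendsto_etaCut _

/-! ### The approximants `f_ν = κ_ν(θ)η_ν(R)f` -/

/-- The cut-off approximant `f_ν(z, θ) = η_ν(z)κ_ν(θ)f(z, θ)`. [folklore] -/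
def cutFun (n : ℝ) (f : ℝ → ℝ → ℝ) : ℝ → ℝ → ℝ := fun z θ => (etaCutPos n z * angCut n θ) * f z θ

/-- On the strip `f_ν = η_ν ⊙_R (κ_ν ⊙_θ f)`. [folklore] -/
theorem cutFun_eq_strip (n : ℝ) (f : ℝ → ℝ → ℝ) : ∀ p ∈ strip, cutFun n f p.1 p.2 = radialMul (etaCut n) (angMul (angCut n) f) p.1 p.2 := by
  intro p hp
  simp only [cutFun, radialMul_apply, angMul_apply, etaCutPos_of_pos hp.1]
  ring

/-- **`f_ν` is a test function of the strip** when `f ∈ C^∞(strip)`. [folklore] -/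
theorem stripTest_cutFun {n : ℝ} (hn : 0 < n) {f : ℝ → ℝ → ℝ} (hf : ContDiffOn ℝ ∞ (uncurry f) strip) : StripTest (cutFun n f) := by
  set χ : ℝ × ℝ → ℝ := fun p => etaCutPos n p.1 * angCut n p.2 with hχ
  have hχs : ContDiff ℝ ∞ χ := ((contDiff_etaCutPos hn).comp contDiff_fst).mul ((contDiff_angCut hn).comp contDiff_snd)
  have hK : IsCompact (tsupport (etaCutPos n) ×ˢ tsupport (angCut n)) := (hasCompactSupport_etaCutPos hn).prod (hasCompactSupport_angCut hn)
  have hsuppχ : support χ ⊆ tsupport (etaCutPos n) ×ˢ tsupport (angCut n) := by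
    intro p hp
    rw [mem_support, hχ] at hp
    exact ⟨subset_tsupport _ (left_ne_zero_of_mul hp), subset_tsupport _ (right_ne_zero_of_mul hp)⟩
  have htχ : tsupport χ ⊆ tsupport (etaCutPos n) ×ˢ tsupport (angCut n) :=
    closure_minimal hsuppχ (hK.isClosed)
  have hχU : tsupport χ ⊆ strip := htχ.trans (Set.prod_mono (tsupport_etaCutPos hn) (tsupport_angCut hn))
  have hsm : ContDiff ℝ ∞ (uncurry (cutFun n f)) := by
    have := Literature.Analysis.Distribution.contDiff_mul_of_tsupport_subset isOpen_strip hχs hχU hf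
    exact this
  have hsupp : support (uncurry (cutFun n f)) ⊆ tsupport (etaCutPos n) ×ˢ tsupport (angCut n) := by
    intro p hp
    rw [mem_support] at hp
    exact hsuppχ (mem_support.2 (left_ne_zero_of_mul hp))
  refine ⟨fun m => hsm.of_le (by exact_mod_cast le_top), HasCompactSupport.of_support_subset_isCompact hK hsupp, ?_⟩
  exact (closure_minimal hsupp hK.isClosed).trans (Set.prod_mono (tsupport_etaCutPos hn) (tsupport_angCut hn))

/-- The coefficient of the word `(i−a, j−b)` in `W_{ij}·D_θ^iD_z^j(f_ν − f)`: `η_νκ_ν − 1` for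
`(a,b) = (0,0)`, `C(j,b)C(i,a)(Dz₁^bη_ν)(Dθ₁^aκ_ν)` otherwise. [folklore] -/
def coefCut (n : ℝ) (i j a b : ℕ) (p : ℝ × ℝ) : ℝ :=
  if a = 0 ∧ b = 0 then etaCut n p.1 * angCut n p.2 - 1
  else ((j.choose b : ℝ) * (i.choose a : ℝ)) * ((Dz₁^[b] (etaCut n)) p.1 * (Dθ₁^[a] (angCut n)) p.2)

/-- The pieces `G_{ab} = coef_{ab}·D_θ^{i−a}D_z^{j−b}f·W_{ij}`. [folklore] -/
def Gcut (α n : ℝ) (f : ℝ → ℝ → ℝ) (i j : ℕ) (ab : ℕ × ℕ) : ℝ → ℝ → ℝ :=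
  fun z θ => coefCut n i j ab.1 ab.2 (z, θ) * (Dθ^[i - ab.1] (Dz^[j - ab.2] f)) z θ * wordWeight α i z θ

/-- **The words of `f_ν − f` on the strip**:
`W_{ij}·D_θ^iD_z^j(f_ν − f) = Σ_{a ≤ i, b ≤ j} G_{ab}`. [folklore] -/
theorem word_cutFun_sub {α n : ℝ} (hn : 0 < n) {f : ℝ → ℝ → ℝ} (hf : ContDiffOn ℝ ∞ (uncurry f) strip) {i j : ℕ} (hij : i + j ≤ 4)
    {p : ℝ × ℝ} (hp : p ∈ strip) :
    (Dθ^[i] (Dz^[j] (cutFun n f - f))) p.1 p.2 * wordWeight α i p.1 p.2 = ∑ ab ∈ range (i + 1) ×ˢ range (j + 1), Gcut α n f i j ab p.1 p.2 := by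
  have h4 : (4 : WithTop ℕ∞) ≤ ((⊤ : ℕ∞) : WithTop ℕ∞) := WithTop.coe_le_coe.2 le_top
  have hf4 : ContDiffOn ℝ 4 (uncurry f) strip := hf.of_le h4
  have hc4 : ContDiffOn ℝ 4 (uncurry (cutFun n f)) strip := (((stripTest_cutFun hn hf).smooth 4).contDiffOn)
  rw [iterate_Dθ_Dz_sub hc4 hf4 hij p hp, iterate_Dθ_Dz_congr (cutFun_eq_strip n f) i j p hp]
  -- Leibniz in `R`, then in `θ`
  have hκ : ContDiffOn ℝ 4 (angCut n) (Ioo 0 (π / 2)) := contDiffOn_angCut hn 4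
  have hη : ContDiffOn ℝ 4 (etaCut n) (Ioi 0) := (contDiffOn_etaCut n).of_le h4
  have hκf : ContDiffOn ℝ 4 (uncurry (angMul (angCut n) f)) strip := by
    have : ContDiffOn ℝ 4 (fun q : ℝ × ℝ => angCut n q.2 * uncurry f q) strip :=
      ((hκ.comp contDiffOn_snd fun q (hq : q ∈ strip) => hq.2).mul hf4)
    exact this.congr fun q _ => rfl
  rw [iterate_Dθ_Dz_radialMul_Ioi hη hκf hij p hp]
  have inner : ∀ b ∈ range (j + 1), (Dθ^[i] (Dz^[j - b] (angMul (angCut n) f))) p.1 p.2 =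
      ∑ a ∈ range (i + 1), (i.choose a : ℝ) * ((Dθ₁^[a] (angCut n)) p.2 * (Dθ^[i - a] (Dz^[j - b] f)) p.1 p.2) := by
    intro b hb
    have hb' : b ≤ j := Nat.lt_succ_iff.mp (mem_range.mp hb)
    exact iterate_Dθ_Dz_angMul_strip hκ hf4 (show i + (j - b) ≤ 4 by omega) p hp
  rw [Finset.sum_congr rfl fun b hb => by rw [inner b hb]]
  -- expand, distribute the weight, and identify the `(0,0)` term
  set W := wordWeight α i p.1 p.2
  set w : ℕ × ℕ → ℝ := fun ab => (Dθ^[i - ab.1] (Dz^[j - ab.2] f)) p.1 p.2 with hw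
  set g : ℕ × ℕ → ℝ := fun ab => ((j.choose ab.2 : ℝ) * (i.choose ab.1 : ℝ)) * ((Dz₁^[ab.2] (etaCut n)) p.1 * (Dθ₁^[ab.1] (angCut n)) p.2) with hg
  have hcoef : ∀ ab : ℕ × ℕ, coefCut n i j ab.1 ab.2 p = g ab - (if ab = (0, 0) then 1 else 0) := by
    rintro ⟨a, b⟩
    by_cases h : a = 0 ∧ b = 0
    · obtain ⟨rfl, rfl⟩ := h
      simp [coefCut, hg]
    · have h' : ((a, b) : ℕ × ℕ) ≠ (0, 0) := by simpa [Prod.ext_iff] using h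
      simp [coefCut, h, h', hg]
  have hR : ∑ ab ∈ range (i + 1) ×ˢ range (j + 1), Gcut α n f i j ab p.1 p.2 =
      (∑ ab ∈ range (i + 1) ×ˢ range (j + 1), g ab * w ab) * W - w (0, 0) * W := by
    have e : ∀ ab ∈ range (i + 1) ×ˢ range (j + 1), Gcut α n f i j ab p.1 p.2 = g ab * w ab * W - (if ab = (0, 0) then w ab * W else 0) := by
      intro ab _
      simp only [Gcut, hcoef ab]
      split_ifs <;> ring
    rw [Finset.sum_congr rfl e, Finset.sum_sub_distrib, Finset.sum_ite_eq' (range (i + 1) ×ˢ range (j + 1)) ((0:ℕ), (0:ℕ)) (fun ab => w ab * W),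
      if_pos (by simp), Finset.sum_mul]
  have hL : (∑ b ∈ range (j + 1), (j.choose b : ℝ) * ((Dz₁^[b] (etaCut n)) p.1 *
      ∑ a ∈ range (i + 1), (i.choose a : ℝ) * ((Dθ₁^[a] (angCut n)) p.2 * (Dθ^[i - a] (Dz^[j - b] f)) p.1 p.2))) =
      ∑ ab ∈ range (i + 1) ×ˢ range (j + 1), g ab * w ab := by
    rw [Finset.sum_product_right]
    refine Finset.sum_congr rfl fun b _ => ?_
    rw [Finset.mul_sum, Finset.mul_sum]
    refine Finset.sum_congr rfl fun a _ => ?_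
    simp only [hg, hw]; ring
  rw [hR, hL]
  simp only [hw, Nat.sub_zero]
  ring

/-! ### The `γ`-weighted radial words and the bounds on the pieces -/

/-- `H(f) = Σ_{j ≤ 3} ∫∫_strip w²(D_z^jf)²sin(2θ)^{−γ}`: the radial words against the angular weight. [folklore] -/
def gammaWords (α : ℝ) (f : ℝ → ℝ → ℝ) : ℝ≥0∞ :=
  ∑ j ∈ range 4, ∫⁻ p in strip, ENNReal.ofReal (radialWeight p.1 ^ 2 * ((Dz^[j] f) p.1 p.2) ^ 2 * Real.sin (2 * p.2) ^ (-gammaExp α))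

/-- Continuity of the `Dθ₁`-iterates of `κ_ν` on `(0, π/2)`. [folklore] -/
theorem continuousOn_iterate_Dθ₁_angCut (n : ℝ) (a : ℕ) : ContinuousOn (Dθ₁^[a] (angCut n)) (Ioo 0 (π / 2)) := by
  refine (ContinuousOn.congr ?_ (iterate_Dθ₁_angCut n a))
  have hc : ContinuousOn (Dz₁^[a] (etaCut n)) (Ioi 0) :=
    (contDiffOn_iterate_Dz₁_Ioi (N := a) ((contDiffOn_etaCut n).of_le (by exact_mod_cast le_top)) (m := 0) le_rfl).continuousOn
  refine continuousOn_const.mul (hc.comp (Real.continuousOn_tan_Ioo.mono fun θ hθ => ⟨by linarith [hθ.1, Real.pi_pos], hθ.2⟩)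
    fun θ hθ => Real.tan_pos_of_pos_of_lt_pi_div_two hθ.1 hθ.2)

/-- Continuity of the coefficients on the strip. [folklore] -/
theorem continuousOn_coefCut (n : ℝ) (i j a b : ℕ) : ContinuousOn (coefCut n i j a b) strip := by
  have hη : ∀ l, ContinuousOn (fun p : ℝ × ℝ => (Dz₁^[l] (etaCut n)) p.1) strip := fun l =>
    ((contDiffOn_iterate_Dz₁_Ioi (N := l) ((contDiffOn_etaCut n).of_le (by exact_mod_cast le_top)) (m := 0) le_rfl).continuousOn).comp
      continuousOn_fst fun p (hp : p ∈ strip) => hp.1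
  have hκ : ∀ l, ContinuousOn (fun p : ℝ × ℝ => (Dθ₁^[l] (angCut n)) p.2) strip := fun l =>
    (continuousOn_iterate_Dθ₁_angCut n l).comp continuousOn_snd fun p (hp : p ∈ strip) => hp.2
  unfold coefCut
  split_ifs
  · have h0 := (hη 0).mul (hκ 0)
    simp only [Function.iterate_zero, id_eq] at h0
    exact h0.sub continuousOn_const
  · exact continuousOn_const.mul ((hη b).mul (hκ a))

/-- The pieces are a.e.-measurable on the strip. [folklore] -/
theorem aemeasurable_Gcut (α n : ℝ) {f : ℝ → ℝ → ℝ} (hf : ContDiffOn ℝ ∞ (uncurry f) strip) {i j : ℕ} (hij : i + j ≤ 4) (ab : ℕ × ℕ) :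
    AEMeasurable (uncurry (Gcut α n f i j ab)) (volume.restrict strip) := by
  have h4 : (4 : WithTop ℕ∞) ≤ ((⊤ : ℕ∞) : WithTop ℕ∞) := WithTop.coe_le_coe.2 le_top
  have hw : ContinuousOn (fun p : ℝ × ℝ => (Dθ^[i - ab.1] (Dz^[j - ab.2] f)) p.1 p.2) strip :=
    continuousOn_iterate_Dθ_Dz (N := 4) (i := i - ab.1) (j := j - ab.2) (hf.of_le h4) (by omega)
  exact (((continuousOn_coefCut n i j ab.1 ab.2).mul hw).mul (continuousOn_wordWeight α i)).aemeasurable measurableSet_strip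

/-- **Uniform constants for the cut-off derivatives**: `|Dz₁^{l+1}η_ν|, |Dθ₁^{l+1}κ_ν| ≤ B/ν` for
`l < 4`, `ν ≥ 1`, with one `B ≥ 1`. [folklore] -/
theorem exists_cut_bound : ∃ B : ℝ, 1 ≤ B ∧ ∀ n : ℝ, 1 ≤ n → ∀ l, l < 4 →
    (∀ z ∈ Ioi (0:ℝ), |(Dz₁^[l + 1] (etaCut n)) z| ≤ B / n) ∧ (∀ θ ∈ Ioo (0:ℝ) (π / 2), |(Dθ₁^[l + 1] (angCut n)) θ| ≤ B / n) := by
  have hz : ∀ l, ∃ B, 0 ≤ B ∧ ∀ n : ℝ, 1 ≤ n → ∀ z ∈ Ioi (0:ℝ), |(Dz₁^[l + 1] (etaCut n)) z| ≤ B / n := fun l =>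
    abs_iterate_Dz₁_logCut_le contDiff_logPlateau hasCompactSupport_logPlateau l
  choose Bz hBz0 hBz using hz
  choose Bθ hBθ0 hBθ using abs_iterate_Dθ₁_angCut_le
  refine ⟨1 + ∑ l ∈ range 4, (Bz l + Bθ l), ?_, fun n hn l hl => ⟨fun z hz' => ?_, fun θ hθ => ?_⟩⟩
  · have : 0 ≤ ∑ l ∈ range 4, (Bz l + Bθ l) := Finset.sum_nonneg fun l _ => add_nonneg (hBz0 l) (hBθ0 l)
    linarith
  · refine (hBz l n hn z hz').trans (div_le_div_of_nonneg_right ?_ (by linarith))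
    have := Finset.single_le_sum (f := fun l => Bz l + Bθ l) (fun l _ => add_nonneg (hBz0 l) (hBθ0 l)) (mem_range.2 hl)
    linarith [hBθ0 l]
  · refine (hBθ l n hn θ hθ).trans (div_le_div_of_nonneg_right ?_ (by linarith))
    have := Finset.single_le_sum (f := fun l => Bz l + Bθ l) (fun l _ => add_nonneg (hBz0 l) (hBθ0 l)) (mem_range.2 hl)
    linarith [hBz0 l]

/-- **The commutator coefficients are `O(1/ν)`**: for `(a,b) ≠ (0,0)`, `a ≤ i ≤ 4`, `b ≤ j ≤ 4`,
`|coef_{ab}| ≤ 256B²/ν` on the strip. [folklore] -/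
theorem abs_coefCut_le {B : ℝ} (hB1 : 1 ≤ B) (hB : ∀ n : ℝ, 1 ≤ n → ∀ l, l < 4 →
      (∀ z ∈ Ioi (0:ℝ), |(Dz₁^[l + 1] (etaCut n)) z| ≤ B / n) ∧ (∀ θ ∈ Ioo (0:ℝ) (π / 2), |(Dθ₁^[l + 1] (angCut n)) θ| ≤ B / n))
    {n : ℝ} (hn : 1 ≤ n) {i j a b : ℕ} (hi : i ≤ 4) (hj : j ≤ 4) (ha : a ≤ i) (hb : b ≤ j) (hab : ¬(a = 0 ∧ b = 0))
    {p : ℝ × ℝ} (hp : p ∈ strip) : |coefCut n i j a b p| ≤ 256 * B ^ 2 / n := by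
  have hn0 : 0 < n := by linarith
  simp only [coefCut, hab, if_false]
  rw [abs_mul, abs_mul (Dz₁^[b] (etaCut n) p.1)]
  have hC : |(j.choose b : ℝ) * (i.choose a : ℝ)| ≤ 256 := by
    rw [abs_of_nonneg (by positivity)]
    calc (j.choose b : ℝ) * (i.choose a : ℝ) ≤ 16 * 16 := mul_le_mul (choose_le_sixteen hj) (choose_le_sixteen hi) (by positivity) (by norm_num)
      _ = 256 := by norm_num
  -- the two factors: one is `≤ B/ν`, the other `≤ B`
  have hηb : |(Dz₁^[b] (etaCut n)) p.1| ≤ (if b = 0 then 1 else B / n) := by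
    split_ifs with h
    · subst h; exact abs_etaCut_le _ _
    · obtain ⟨l, rfl⟩ := Nat.exists_eq_succ_of_ne_zero h
      exact (hB n hn l (by omega)).1 p.1 hp.1
  have hκa : |(Dθ₁^[a] (angCut n)) p.2| ≤ (if a = 0 then 1 else B / n) := by
    split_ifs with h
    · subst h; exact abs_angCut_le _ _
    · obtain ⟨l, rfl⟩ := Nat.exists_eq_succ_of_ne_zero h
      exact (hB n hn l (by omega)).2 p.2 hp.2
  have hprod : |(Dz₁^[b] (etaCut n)) p.1| * |(Dθ₁^[a] (angCut n)) p.2| ≤ B ^ 2 / n := by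
    have hBn : B / n ≤ B := div_le_self (by linarith) hn
    have hBn0 : 0 ≤ B / n := by positivity
    by_cases hb0 : b = 0
    · have ha0 : a ≠ 0 := fun h => hab ⟨h, hb0⟩
      subst hb0
      simp only [↓reduceIte] at hηb
      simp only [ha0, ↓reduceIte] at hκa
      calc |(Dz₁^[0] (etaCut n)) p.1| * |(Dθ₁^[a] (angCut n)) p.2| ≤ 1 * (B / n) := mul_le_mul hηb hκa (abs_nonneg _) zero_le_one
        _ ≤ B ^ 2 / n := by rw [one_mul, sq, mul_div_assoc]; exact le_mul_of_one_le_left hBn0 hB1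
    · simp only [hb0, ↓reduceIte] at hηb
      have hκ' : |(Dθ₁^[a] (angCut n)) p.2| ≤ B := by
        split_ifs at hκa with h
        · exact hκa.trans hB1
        · exact hκa.trans hBn
      calc _ ≤ (B / n) * B := mul_le_mul hηb hκ' (abs_nonneg _) hBn0
        _ = B ^ 2 / n := by ring
  calc |(j.choose b : ℝ) * (i.choose a : ℝ)| * (|(Dz₁^[b] (etaCut n)) p.1| * |(Dθ₁^[a] (angCut n)) p.2|) ≤ 256 * (B ^ 2 / n) :=
        mul_le_mul hC hprod (mul_nonneg (abs_nonneg _) (abs_nonneg _)) (by norm_num)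
    _ = 256 * B ^ 2 / n := by ring

/-- **The weighted word `D_θ^{i−a}D_z^{j−b}f` against the weight of the slot `(i,j)`** is controlled by
`|f|²_{𝓗⁴} + H(f)`. [folklore] -/
theorem lintegral_word_slot_le (α : ℝ) (f : ℝ → ℝ → ℝ) {i j a b : ℕ} (hij : i + j ≤ 4) (ha : a ≤ i) (hb : b ≤ j) :
    ∫⁻ p in strip, ENNReal.ofReal (((Dθ^[i - a] (Dz^[j - b] f)) p.1 p.2 * wordWeight α i p.1 p.2) ^ 2) ≤ eHkNormSq α 4 f + gammaWords α f := by
  by_cases hcase : i = 0 ∨ 1 ≤ i - a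
  · -- same weight as the word's own slot
    have hw : ∀ p : ℝ × ℝ, wordWeight α i p.1 p.2 = wordWeight α (i - a) p.1 p.2 := by
      intro p; unfold wordWeight
      rcases hcase with h | h
      · subst h; simp
      · have h1 : i ≠ 0 := by omega
        have h2 : i - a ≠ 0 := by omega
        simp [h1, h2]
    calc _ = eL2Sq (fun z θ => (Dθ^[i - a] (Dz^[j - b] f)) z θ * wordWeight α (i - a) z θ) := by
          rw [eL2Sq_eq_lintegral_ofReal]
          exact setLIntegral_congr_fun measurableSet_strip fun p _ => by rw [hw p]
      _ ≤ eHkNormSq α 4 f := eL2Sq_weighted_word_le α (by omega) f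
      _ ≤ _ := le_self_add
  · -- `a = i ≥ 1`: a radial word against `sin^{-γ}`
    simp only [not_or, not_le] at hcase
    have hia : i - a = 0 := by omega
    have hi0 : i ≠ 0 := hcase.1
    have hjb : j - b < 4 := by omega
    calc _ = ∫⁻ p in strip, ENNReal.ofReal (radialWeight p.1 ^ 2 * ((Dz^[j - b] f) p.1 p.2) ^ 2 * Real.sin (2 * p.2) ^ (-gammaExp α)) := by
          refine setLIntegral_congr_fun measurableSet_strip fun p hp => ?_
          rw [hia, Function.iterate_zero, id_eq]
          simp only [wordWeight, hi0, ↓reduceIte]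
          rw [sq_mul_totalWeight α hp]; simp only [wGam]; congr 1; ring
      _ ≤ gammaWords α f := by
          unfold gammaWords
          exact Finset.single_le_sum (f := fun j' => ∫⁻ p in strip, ENNReal.ofReal (radialWeight p.1 ^ 2 * ((Dz^[j'] f) p.1 p.2) ^ 2 * Real.sin (2 * p.2) ^ (-gammaExp α)))
            (fun _ _ => bot_le) (Finset.mem_range.2 hjb)
      _ ≤ _ := le_add_self

set_option maxHeartbeats 800000 in
/-- **Density of the test functions (Elgindi 2021, Remark 8.3)**: for `f ∈ C^∞(strip)` with finite
`𝓗⁴` functional and finite `γ`-weighted radial words, `|f_{n+1} − f|²_{𝓗⁴} → 0`. [cite: Elgindi2021, §8.1 Remark 8.3 (p. 25 of arXiv:1904.04795)] -/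
theorem tendsto_eHkNormSq_cutFun_sub (α : ℝ) {f : ℝ → ℝ → ℝ} (hf : ContDiffOn ℝ ∞ (uncurry f) strip)
    (hE : eHkNormSq α 4 f < ⊤) (hH : gammaWords α f < ⊤) :
    Tendsto (fun n : ℕ => eHkNormSq α 4 (cutFun (n + 1 : ℝ) f - f)) atTop (𝓝 0) := by
  have h4 : (4 : WithTop ℕ∞) ≤ ((⊤ : ℕ∞) : WithTop ℕ∞) := WithTop.coe_le_coe.2 le_top
  have hf4 : ContDiffOn ℝ 4 (uncurry f) strip := hf.of_le h4
  obtain ⟨B, hB1, hB⟩ := exists_cut_bound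
  have hn1 : ∀ n : ℕ, (1:ℝ) ≤ n + 1 := fun n => by have := n.cast_nonneg (α := ℝ); linarith
  have hn0 : ∀ n : ℕ, (0:ℝ) < n + 1 := fun n => by positivity
  -- (1) every piece tends to zero
  have hpiece : ∀ i j, i + j ≤ 4 → ∀ ab ∈ range (i + 1) ×ˢ range (j + 1),
      Tendsto (fun n : ℕ => eL2Sq (Gcut α (n + 1 : ℝ) f i j ab)) atTop (𝓝 0) := by
    intro i j hij ab hab
    rw [Finset.mem_product, Finset.mem_range, Finset.mem_range] at hab
    have hslot := lintegral_word_slot_le α f hij (show ab.1 ≤ i by omega) (show ab.2 ≤ j by omega)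
    have hJtop : eHkNormSq α 4 f + gammaWords α f ≠ ⊤ := ENNReal.add_ne_top.2 ⟨hE.ne, hH.ne⟩
    by_cases h00 : ab.1 = 0 ∧ ab.2 = 0
    · -- dominated convergence
      obtain ⟨a, b⟩ := ab
      simp only at h00
      obtain ⟨rfl, rfl⟩ := h00
      set bound : ℝ × ℝ → ℝ≥0∞ := fun p => ENNReal.ofReal (((Dθ^[i] (Dz^[j] f)) p.1 p.2 * wordWeight α i p.1 p.2) ^ 2)
      have hfin : ∫⁻ p in strip, bound p ≠ ⊤ := by
        refine ne_top_of_le_ne_top hJtop ?_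
        have := lintegral_word_slot_le α f hij (Nat.zero_le i) (Nat.zero_le j)
        simpa using this
      have hconv := tendsto_lintegral_of_dominated_convergence' (μ := volume.restrict strip)
        (F := fun (n : ℕ) (p : ℝ × ℝ) => ENNReal.ofReal ((Gcut α (n + 1 : ℝ) f i j (0, 0) p.1 p.2) ^ 2)) (f := fun _ => 0) bound
        (fun n => ((aemeasurable_Gcut α (n + 1 : ℝ) hf hij (0, 0)).pow_const 2).ennreal_ofReal)
        (fun n => (ae_restrict_iff' measurableSet_strip).2 (ae_of_all _ fun p hp => ?_)) hfin
        ((ae_restrict_iff' measurableSet_strip).2 (ae_of_all _ fun p hp => ?_))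
      · simp only [lintegral_zero] at hconv
        refine hconv.congr fun n => ?_
        rw [eL2Sq_eq_lintegral_ofReal]
      · -- domination `(ηκ − 1)² ≤ 1`
        simp only [bound, Gcut, coefCut, and_self, ↓reduceIte, Nat.sub_zero]
        refine ENNReal.ofReal_le_ofReal ?_
        have hη := etaCut_mem_Icc (n + 1 : ℝ) p.1
        have hκ := angCut_mem_Icc (n + 1 : ℝ) p.2
        have hc : (etaCut (n + 1 : ℝ) p.1 * angCut (n + 1 : ℝ) p.2 - 1) ^ 2 ≤ 1 := by
          have h0 : 0 ≤ etaCut (n + 1 : ℝ) p.1 * angCut (n + 1 : ℝ) p.2 := mul_nonneg hη.1 hκ.1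
          have h1 : etaCut (n + 1 : ℝ) p.1 * angCut (n + 1 : ℝ) p.2 ≤ 1 := mul_le_one₀ hη.2 hκ.1 hκ.2
          nlinarith
        calc (( etaCut (n + 1 : ℝ) p.1 * angCut (n + 1 : ℝ) p.2 - 1) * (Dθ^[i] (Dz^[j] f)) p.1 p.2 * wordWeight α i p.1 p.2) ^ 2
            = (etaCut (n + 1 : ℝ) p.1 * angCut (n + 1 : ℝ) p.2 - 1) ^ 2 * ((Dθ^[i] (Dz^[j] f)) p.1 p.2 * wordWeight α i p.1 p.2) ^ 2 := by ring
          _ ≤ 1 * ((Dθ^[i] (Dz^[j] f)) p.1 p.2 * wordWeight α i p.1 p.2) ^ 2 := mul_le_mul_of_nonneg_right hc (sq_nonneg _)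
          _ = _ := one_mul _
      · -- pointwise limit `0`
        simp only [Gcut, coefCut, and_self, ↓reduceIte, Nat.sub_zero]
        have ht : Tendsto (fun n : ℕ => etaCut (n + 1 : ℝ) p.1 * angCut (n + 1 : ℝ) p.2 - 1) atTop (𝓝 (1 * 1 - 1)) :=
          ((tendsto_etaCut p.1).mul (tendsto_angCut hp.2)).sub tendsto_const_nhds
        have := ENNReal.tendsto_ofReal (((ht.mul_const ((Dθ^[i] (Dz^[j] f)) p.1 p.2)).mul_const (wordWeight α i p.1 p.2)).pow 2)
        simpa using this
    · -- the commutator pieces are `O(1/ν²)`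
      set c : ℕ → ℝ := fun n => 256 * B ^ 2 / (n + 1 : ℝ) with hc
      have hbound : ∀ n : ℕ, eL2Sq (Gcut α (n + 1 : ℝ) f i j ab) ≤ ENNReal.ofReal (c n ^ 2) * (eHkNormSq α 4 f + gammaWords α f) := by
        intro n
        refine le_trans ?_ (mul_le_mul_right hslot _)
        rw [eL2Sq_eq_lintegral_ofReal, ← lintegral_const_mul' _ _ ENNReal.ofReal_ne_top]
        refine setLIntegral_mono' measurableSet_strip fun p hp => ?_
        rw [← ENNReal.ofReal_mul (sq_nonneg _)]
        refine ENNReal.ofReal_le_ofReal ?_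
        simp only [Gcut]
        have hco := abs_coefCut_le hB1 hB (hn1 n) (i := i) (j := j) (a := ab.1) (b := ab.2) (by omega) (by omega) (by omega) (by omega) h00 hp
        rw [show (coefCut (n + 1 : ℝ) i j ab.1 ab.2 (p.1, p.2) * (Dθ^[i - ab.1] (Dz^[j - ab.2] f)) p.1 p.2 * wordWeight α i p.1 p.2) ^ 2 =
          (coefCut (n + 1 : ℝ) i j ab.1 ab.2 p) ^ 2 * ((Dθ^[i - ab.1] (Dz^[j - ab.2] f)) p.1 p.2 * wordWeight α i p.1 p.2) ^ 2 by
            rw [show ((p.1, p.2) : ℝ × ℝ) = p from rfl]; ring]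
        refine mul_le_mul_of_nonneg_right ?_ (sq_nonneg _)
        rw [← sq_abs]
        exact pow_le_pow_left₀ (abs_nonneg _) hco 2
      have hc0 : Tendsto (fun n : ℕ => ENNReal.ofReal (c n ^ 2) * (eHkNormSq α 4 f + gammaWords α f)) atTop (𝓝 0) := by
        have h1 : Tendsto c atTop (𝓝 0) := by
          have h0 : Tendsto (fun n : ℕ => 256 * B ^ 2 / ((n : ℝ) + 1)) atTop (𝓝 0) :=
            tendsto_const_nhds.div_atTop (tendsto_atTop_add_const_right _ 1 tendsto_natCast_atTop_atTop)
          exact h0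
        have h2 : Tendsto (fun n => ENNReal.ofReal (c n ^ 2)) atTop (𝓝 0) := by
          have := ENNReal.tendsto_ofReal (h1.pow 2)
          simpa using this
        have := ENNReal.Tendsto.mul_const h2 (Or.inr hJtop)
        rwa [zero_mul] at this
      exact tendsto_of_tendsto_of_tendsto_of_le_of_le tendsto_const_nhds hc0 (fun _ => bot_le) hbound
  -- (2) every term of the functional is bounded by the pieces
  set Bn : ℕ → ℝ≥0∞ := fun n => ∑ w ∈ (range 5 ×ˢ range 5).filter (fun w : ℕ × ℕ => w.1 + w.2 ≤ 4),
    ENNReal.ofReal 25 * ∑ ab ∈ range (w.1 + 1) ×ˢ range (w.2 + 1), eL2Sq (Gcut α (n + 1 : ℝ) f w.1 w.2 ab) with hBn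
  have hterm : ∀ n : ℕ, ∀ i j, i + j ≤ 4 →
      eL2Sq (fun z θ => (Dθ^[i] (Dz^[j] (cutFun (n + 1 : ℝ) f - f))) z θ * wordWeight α i z θ) ≤ Bn n := by
    intro n i j hij
    have hle := eL2Sq_le_of_sq_le_sum (range (i + 1) ×ˢ range (j + 1)) (g := fun z θ => (Dθ^[i] (Dz^[j] (cutFun (n + 1 : ℝ) f - f))) z θ * wordWeight α i z θ)
      (G := Gcut α (n + 1 : ℝ) f i j) (C := 25) (by norm_num) (fun ab _ => aemeasurable_Gcut α (n + 1 : ℝ) hf hij ab) (fun p hp => by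
        rw [word_cutFun_sub (hn0 n) hf hij hp]
        refine (sq_sum_le_card_mul_sum_sq (s := range (i + 1) ×ˢ range (j + 1)) (f := fun ab => Gcut α (n + 1 : ℝ) f i j ab p.1 p.2)).trans ?_
        refine mul_le_mul_of_nonneg_right ?_ (Finset.sum_nonneg fun _ _ => sq_nonneg _)
        rw [Finset.card_product, Finset.card_range, Finset.card_range]
        have : (i + 1) * (j + 1) ≤ 25 := by nlinarith
        exact_mod_cast this)
    refine hle.trans ?_
    have hmem : ((i, j) : ℕ × ℕ) ∈ (range 5 ×ˢ range 5).filter (fun w : ℕ × ℕ => w.1 + w.2 ≤ 4) := by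
      rw [Finset.mem_filter, Finset.mem_product, Finset.mem_range, Finset.mem_range]; exact ⟨⟨by omega, by omega⟩, hij⟩
    exact Finset.single_le_sum (f := fun w : ℕ × ℕ => ENNReal.ofReal 25 * ∑ ab ∈ range (w.1 + 1) ×ˢ range (w.2 + 1), eL2Sq (Gcut α (n + 1 : ℝ) f w.1 w.2 ab))
      (fun _ _ => bot_le) (a := (i, j)) hmem
  have hE4 : ∀ n : ℕ, eHkNormSq α 4 (cutFun (n + 1 : ℝ) f - f) ≤ (((4 + 1) + (4 + 1) ^ 2 : ℕ) : ℝ≥0∞) * Bn n := by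
    intro n
    refine eHkNormSq_le_of_forall_le (fun j hj => ?_) (fun i j hi hij => ?_)
    · have := hterm n 0 j (by omega)
      have e : (fun z θ => (Dθ^[0] (Dz^[j] (cutFun (n + 1 : ℝ) f - f))) z θ * wordWeight α 0 z θ) = hkRadialTerm j (cutFun (n + 1 : ℝ) f - f) := by
        funext z θ; simp [wordWeight, hkRadialTerm]
      rwa [e] at this
    · have := hterm n i j hij
      have hi0 : i ≠ 0 := by omega
      have e : (fun z θ => (Dθ^[i] (Dz^[j] (cutFun (n + 1 : ℝ) f - f))) z θ * wordWeight α i z θ) = hkMixedTerm α i j (cutFun (n + 1 : ℝ) f - f) := by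
        funext z θ; simp [wordWeight, hkMixedTerm, hi0]
      rwa [e] at this
  -- (3) `Bn → 0`
  have hBn0 : Tendsto Bn atTop (𝓝 0) := by
    have : Tendsto Bn atTop (𝓝 (∑ w ∈ (range 5 ×ˢ range 5).filter (fun w : ℕ × ℕ => w.1 + w.2 ≤ 4),
        ENNReal.ofReal 25 * ∑ ab ∈ range (w.1 + 1) ×ˢ range (w.2 + 1), (0:ℝ≥0∞))) := by
      refine tendsto_finsetSum _ fun w hw => ?_
      rw [Finset.mem_filter] at hw
      refine ENNReal.Tendsto.const_mul (tendsto_finsetSum _ fun ab hab => hpiece w.1 w.2 hw.2 ab hab) (Or.inr ENNReal.ofReal_ne_top)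
    simpa using this
  have h30 : Tendsto (fun n => (((4 + 1) + (4 + 1) ^ 2 : ℕ) : ℝ≥0∞) * Bn n) atTop (𝓝 0) := by
    have := ENNReal.Tendsto.const_mul hBn0 (a := (((4 + 1) + (4 + 1) ^ 2 : ℕ) : ℝ≥0∞)) (Or.inr (ENNReal.natCast_ne_top _))
    rwa [mul_zero] at this
  exact tendsto_of_tendsto_of_tendsto_of_le_of_le tendsto_const_nhds h30 (fun _ => bot_le) hE4

/-- **The membership criterion**: `f ∈ C^∞(strip)` with `|f|²_{𝓗⁴} < ∞` and `H(f) < ∞` is in the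
`𝓗⁴`-closure of the test functions. [cite: Elgindi2021, §8.1 Remark 8.3 (p. 25 of arXiv:1904.04795)] -/
theorem hkApprox_cutFun (α : ℝ) {f : ℝ → ℝ → ℝ} (hf : ContDiffOn ℝ ∞ (uncurry f) strip)
    (hE : eHkNormSq α 4 f < ⊤) (hH : gammaWords α f < ⊤) : HkApprox α f (fun n : ℕ => cutFun (n + 1 : ℝ) f) :=
  ⟨hf, fun n => stripTest_cutFun (by positivity) hf, tendsto_eHkNormSq_cutFun_sub α hf hE hH⟩

/-! ### Corollaries: the estimates on the class `{f ∈ C^∞(strip), |f|_{𝓗⁴} < ∞, H(f) < ∞}` -/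

/-- **The product rule (Elgindi Lemma 8.5 / EGM Proposition 9.2) on the faithful class.** [cite: ElgindiGhoulMasmoudi2021, §9 Proposition 9.2 (p. 20 of arXiv:1910.14071); Elgindi2021, §8.1 Lemma 8.5 and Remark 8.3 (p. 25 of arXiv:1904.04795)] -/
theorem eHkNormSq_mul_le_data {α : ℝ} (hα : 0 < α) (hα10 : α ≤ 10) {f g : ℝ → ℝ → ℝ}
    (hf : ContDiffOn ℝ ∞ (uncurry f) strip) (hEf : eHkNormSq α 4 f < ⊤) (hHf : gammaWords α f < ⊤)
    (hg : ContDiffOn ℝ ∞ (uncurry g) strip) (hEg : eHkNormSq α 4 g < ⊤) (hHg : gammaWords α g < ⊤) :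
    eHkNormSq α 4 (f * g) ≤ 4 * ENNReal.ofReal (30 * (25 * 65536 * 25) * (π / (3 * (gammaExp α - 1)))) * (eHkNormSq α 4 f * eHkNormSq α 4 g) :=
  eHkNormSq_mul_le_closure hα hα10 (hkApprox_cutFun α hf hEf hHf) (hkApprox_cutFun α hg hEg hHg)

/-- **The `L^∞` bound of the low words (Elgindi Corollary 8.2/8.4) on the faithful class.** [cite: Elgindi2021, §8.1 Corollaries 8.2, 8.4 (p. 25 of arXiv:1904.04795)] -/
theorem sq_word_le_data {α : ℝ} (hα : 0 < α) (hα10 : α ≤ 10) {f : ℝ → ℝ → ℝ}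
    (hf : ContDiffOn ℝ ∞ (uncurry f) strip) (hEf : eHkNormSq α 4 f < ⊤) (hHf : gammaWords α f < ⊤)
    {a b : ℕ} (hab : a + b ≤ 2) {p : ℝ × ℝ} (hp : p ∈ strip) :
    ENNReal.ofReal (((Dθ^[a] (Dz^[b] f)) p.1 p.2) ^ 2) ≤ 2 * ENNReal.ofReal (π / (3 * (gammaExp α - 1))) * eHkNormSq α 4 f :=
  sq_word_le_closure hα hα10 (hkApprox_cutFun α hf hEf hHf) hab hp

/-- **The `γ`-weighted radial words on the faithful class**: `∫∫ w²(D_z^jf)²s^{−γ} ≤ 2(π/(γ−1))²|f|²_{𝓗⁴}`,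
`j ≤ 3` — a posteriori `H(f) ≤ 8(π/(γ−1))²|f|²_{𝓗⁴}` once `H(f) < ∞`. [folklore] -/
theorem lintegral_radialWord_le_data {α : ℝ} (hα : 0 < α) (hα10 : α ≤ 10) {f : ℝ → ℝ → ℝ}
    (hf : ContDiffOn ℝ ∞ (uncurry f) strip) (hEf : eHkNormSq α 4 f < ⊤) (hHf : gammaWords α f < ⊤) {j : ℕ} (hj : j ≤ 3) :
    ∫⁻ p in strip, ENNReal.ofReal (radialWeight p.1 ^ 2 * ((Dz^[j] f) p.1 p.2) ^ 2 * Real.sin (2 * p.2) ^ (-gammaExp α)) ≤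
      2 * ENNReal.ofReal ((π / (gammaExp α - 1)) ^ 2) * eHkNormSq α 4 f :=
  lintegral_radialWord_le_closure hα hα10 (hkApprox_cutFun α hf hEf hHf) hj

end Elgindi

end Literature.Analysis.FluidPDE
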